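import Literature.Probability.RandomPlanarGeometry.StarHullCanonical
import Literature.Probability.RandomPlanarGeometry.FlatHulls
import Mathlib.Analysis.Complex.BorelCaratheodory
import HarnessLib

/-!
# Thin `*`-hulls have a small hydrodynamic constant `L`

For a `*`-hull `Q` (`IsStarHull`) with canonical restriction map `Φ_Q = starRMap Q`, reflected
map `E_Q = starMap Q` and hydrodynamic constant `L_Q = starShift Q` (`StarHullCanonical`:
`E_Q(z) = z + L_Q + o(1)` at `∞`, `E_Q(0) = 0`, so `L_Q = -g_Q(0)` for `g_Q = E_Q - L_Q`) we
prove: **if `Q ⊆ {c ≤ |Re w| ≤ M, Im w ≤ θ}` then `|L_Q| ≤ C(c, M) θ`**, in `ε`–`θ` form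
(`exists_forall_abs_starShift_le_of_thin`), as needed for the continuity of `t ↦ L_{B_t}` in the
locality argument of Lawler–Schramm–Werner (2003), §5 (`W̃_t = W_t + L_A - L_{B_t}`); cf.
Lawler (2005), §3.4 (3.12) `|g_A(z) - z| ≤ 3 rad(A)`, here with the HEIGHT instead of the radius
for hulls bounded away from `0` and `∞`. Function-theoretic proof:

* `IsStarHull.im_sub_le_im_starRMap` — **`im z - θ ≤ im Φ_Q(z)`** on `ℍ ∖ Q` when
  `Q ⊆ {Im ≤ θ}` (maximum modulus for `exp(-i(Φ_Q⁻¹(w) - w))` on truncated half-discs, the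
  argument of `IsSlitHull.im_sub_height_le_im_ext` of `FlatHulls` for general `*`-hulls);
* hence `h_Q = g_Q - id` has **`|im h_Q| ≤ θ` on `ℂ ∖ (Q ∪ Q̄)`** (`abs_im_starMap_sub_le`);
* far field: `g_Q` is `IsHydrodynamicAt` outside `B̄(0, r) ⊇ Q` (`isHydrodynamicAt_starMap_sub`),
  so Borel–Carathéodory for the inverted function `h_Q(1/w)` (vanishing at `0`) gives
  **`|h_Q(z)| ≤ 2θ` for `|z| ≥ 2r`** (`norm_starMap_sub_le_of_le_norm`);
* near field: Borel–Carathéodory chained along the connected open set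
  `{|Re z| < c} ∪ {Im z > 1}` from `2(M + 1) i` to `0`, uniformly in `Q`
  (`exists_forall_norm_le_mul_of_abs_im_le` of `FlatHulls`): `|L_Q| = |h_Q(0)| ≤ C θ`.

## References

* G. F. Lawler, O. Schramm, W. Werner, *Conformal restriction: the chordal case*, J. Amer.
  Math. Soc. 16 (2003), §5 [LawlerSchrammWerner2003Restriction].
* G. F. Lawler, *Conformally Invariant Processes in the Plane*, AMS (2005), §3.4
  (Prop. 3.36, (3.7), (3.12)) [Lawler2005].
-/

noncomputable section

open Set Filter Metric Bornology Function
open _root_.Complex _root_.Topology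
open UpperHalfPlane (upperHalfPlaneSet isOpen_upperHalfPlaneSet)
open Literature.Analysis.Complex (IsHydrodynamicAt invertAt)
open scoped ComplexConjugate

namespace Literature.Probability.RandomPlanarGeometry

variable {Q : Set ℂ}

/-- Points outside a closed disc about `0` containing `Q` lie in the symmetric domain.
[folklore] -/
theorem mem_symmDomain_of_lt_norm {r : ℝ} (hQr : Q ⊆ closedBall (0 : ℂ) r) {z : ℂ}
    (hz : r < ‖z‖) : z ∈ symmDomain Q := by
  refine ⟨fun h ↦ ?_, fun h ↦ ?_⟩
  · have := mem_closedBall_zero_iff.1 (hQr h); linarith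
  · have := mem_closedBall_zero_iff.1 (hQr h); rw [norm_conj] at this; linarith

/-! ### The lower bound `im z - θ ≤ im Φ_Q(z)` for a `*`-hull of height `θ` -/

namespace IsStarHull

variable (hQ : IsStarHull Q)
include hQ

/-- `Φ_Q⁻¹` is bounded on bounded subsets of `ℍ` (`Φ_Q → ∞` at `∞`). [folklore] -/
theorem exists_forall_norm_starRMap_symm_le (R : ℝ) :
    ∃ N : ℝ, ∀ w ∈ upperHalfPlaneSet, ‖w‖ ≤ R → ‖(starRMap Q hQ).symm w‖ ≤ N := by
  have hinf := (isRestrictionMap_starRMap hQ).tendsto_cocompact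
  rw [← cobounded_eq_cocompact (α := ℂ)] at hinf
  obtain ⟨N, -, hN⟩ := (Filter.hasBasis_cobounded_norm.inf_principal _).tendsto_iff
    Filter.hasBasis_cobounded_norm |>.1 hinf (R + 1) trivial
  refine ⟨N, fun w hw hwR ↦ ?_⟩
  by_contra hlt
  push Not at hlt
  have := hN ((starRMap Q hQ).symm w) ⟨hlt.le, (starRMap Q hQ).symm_mapsTo hw⟩
  simp only [mem_setOf_eq, (starRMap Q hQ).apply_symm_apply hw] at this
  linarith

/-- **Boundary values of `Φ_Q⁻¹` at the real axis lie in `{Im ≤ θ}`** when `Q ⊆ {Im ≤ θ}`: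
uniformly on bounded sets, `im Φ_Q⁻¹(w) < θ + ε` once `im w` is small (cluster values of
`Φ_Q⁻¹` at real points lie in `ℝ ∪ Q`). [folklore] -/
theorem exists_forall_im_starRMap_symm_lt {θ : ℝ} (hθ : 0 ≤ θ) (hQθ : ∀ z ∈ Q, z.im ≤ θ)
    {ε : ℝ} (hε : 0 < ε) (R : ℝ) : ∃ η > 0, ∀ w ∈ upperHalfPlaneSet, ‖w‖ ≤ R → w.im ≤ η →
      ((starRMap Q hQ).symm w).im < θ + ε := by
  by_contra hno
  push Not at hno
  choose w hwH hwR hwim hΨ using fun n : ℕ ↦ hno (1 / ((n : ℝ) + 1)) (by positivity)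
  set Φ := starRMap Q hQ with hΦdef
  obtain ⟨N, hN⟩ := hQ.exists_forall_norm_starRMap_symm_le R
  have hbdd : ∀ n, Φ.symm (w n) ∈ closedBall (0 : ℂ) N := fun n ↦
    mem_closedBall_zero_iff.2 (hN _ (hwH n) (hwR n))
  obtain ⟨P, -, φ, hφ, hlim⟩ := tendsto_subseq_of_bounded isBounded_closedBall hbdd
  have hPim : θ + ε ≤ P.im :=
    ge_of_tendsto ((continuous_im.tendsto P).comp hlim) (Eventually.of_forall fun n ↦ hΨ (φ n))
  by_cases hPB : P ∈ Q
  · linarith [hQθ P hPB]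
  · have hPU : P ∈ upperHalfPlaneSet \ Q := ⟨show 0 < P.im by linarith, hPB⟩
    have hopen : IsOpen (upperHalfPlaneSet \ Q) :=
      isOpen_upperHalfPlaneSet.sdiff hQ.isBoundedHull.isClosed
    have hcont : ContinuousAt Φ P :=
      (Φ.differentiableOn_coe.differentiableAt (hopen.mem_nhds hPU)).continuousAt
    have h1 : Tendsto (fun n ↦ Φ (Φ.symm (w (φ n)))) atTop (𝓝 (Φ P)) := hcont.tendsto.comp hlim
    have h2 : ∀ n, Φ (Φ.symm (w (φ n))) = w (φ n) := fun n ↦ Φ.apply_symm_apply (hwH _)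
    simp_rw [h2] at h1
    have h3 : Tendsto (fun n ↦ (w (φ n)).im) atTop (𝓝 (Φ P).im) :=
      (continuous_im.tendsto _).comp h1
    have h4 : Tendsto (fun n ↦ (w (φ n)).im) atTop (𝓝 0) :=
      squeeze_zero (fun n ↦ (le_of_lt (hwH (φ n)))) (fun n ↦ hwim (φ n))
        (tendsto_one_div_add_atTop_nhds_zero_nat.comp hφ.tendsto_atTop)
    have := tendsto_nhds_unique h3 h4
    linarith [show 0 < (Φ P).im from Φ.mapsTo hPU]

/-- **Thin hulls do not push far down: `im z - θ ≤ im Φ_Q(z)`** for a `*`-hull `Q ⊆ {Im ≤ θ}`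
and `z ∈ ℍ ∖ Q`. Maximum modulus for `f(w) = exp(-i(Φ_Q⁻¹(w) - w))`, `|f| = e^{im Φ_Q⁻¹ - im w}`,
on truncated half-discs `{im w > η} ∩ B(0, R)`: on the outer arc `Φ_Q⁻¹(w) - w → -L_Q ∈ ℝ`, on
the bottom edge `im Φ_Q⁻¹ < θ + ε` by the boundary values of `Φ_Q⁻¹`.
[cite: Lawler2005, §3.4 (3.7) and Prop. 3.36] -/
theorem im_sub_le_im_starRMap {θ : ℝ} (hθ : 0 ≤ θ) (hQθ : ∀ z ∈ Q, z.im ≤ θ)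
    {z : ℂ} (hz : z ∈ upperHalfPlaneSet \ Q) : z.im - θ ≤ (starRMap Q hQ z).im := by
  set Φ := starRMap Q hQ with hΦdef
  set Ψ := Φ.symm with hΨdef
  have hΦr : IsRestrictionMap Q Φ := isRestrictionMap_starRMap hQ
  have hLim : (hullShift Φ).im = 0 := hullShift_im hQ.isBoundedHull hΦr
  -- it suffices to show `im Ψ w₀ - im w₀ ≤ θ` at `w₀ = Φ z`
  set w₀ := Φ z with hw₀
  have hw₀H : w₀ ∈ upperHalfPlaneSet := Φ.mapsTo hz
  have hΨw₀ : Ψ w₀ = z := Φ.symm_apply_apply hz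
  suffices key : (Ψ w₀).im - w₀.im ≤ θ by rw [hΨw₀] at key; linarith
  -- the function `f`
  set f : ℂ → ℂ := fun w ↦ exp (-I * (Ψ w - w)) with hf
  have hnorm : ∀ w, ‖f w‖ = Real.exp ((Ψ w).im - w.im) := fun w ↦ by
    simp only [hf, norm_exp, neg_mul, neg_re, mul_re, I_re, zero_mul, I_im, one_mul, zero_sub,
      sub_im, neg_neg]
  have hfd : DifferentiableOn ℂ f upperHalfPlaneSet :=
    ((differentiableOn_const _).mul (Φ.symm.differentiableOn_coe.sub differentiableOn_id)).cexp
  suffices key : ∀ ε : ℝ, 0 < ε → ‖f w₀‖ ≤ Real.exp (θ + ε) by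
    by_contra hlt
    have := key _ (show 0 < ((Ψ w₀).im - w₀.im - θ) / 2 by linarith)
    rw [hnorm, Real.exp_le_exp] at this
    linarith
  intro ε hε
  -- radius beyond which `|im (Ψ w - w)| < ε` (`Ψ w - w → -L ∈ ℝ`)
  obtain ⟨R₀, hR₀⟩ : ∃ R₀ : ℝ, ∀ w ∈ upperHalfPlaneSet, R₀ < ‖w‖ → (Ψ w).im - w.im < ε := by
    have hev := (hΦr.tendsto_symm_sub_self hQ).eventually (Metric.ball_mem_nhds (-hullShift Φ) hε)
    rw [← cobounded_eq_cocompact] at hev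
    obtain ⟨R₀, -, hR⟩ :=
      ((hasBasis_cobounded_compl_closedBall (0 : ℂ)).inf_principal _).eventually_iff.1 hev
    refine ⟨R₀, fun w hw hwR ↦ ?_⟩
    have h1 := hR ⟨by simpa using hwR, hw⟩
    rw [dist_eq_norm, sub_neg_eq_add] at h1
    have h2 := abs_im_le_norm (Ψ w - w + hullShift Φ)
    rw [add_im, sub_im, hLim, add_zero] at h2
    linarith [le_abs_self ((Ψ w).im - w.im)]
  set R : ℝ := max R₀ ‖w₀‖ + 1 with hR
  -- height below which `im Ψ < θ + ε` on `‖w‖ ≤ R`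
  obtain ⟨η₀, hη₀, hη₀Ψ⟩ := hQ.exists_forall_im_starRMap_symm_lt hθ hQθ hε R
  set η : ℝ := min η₀ w₀.im / 2 with hη
  have hw₀im : 0 < w₀.im := hw₀H
  have hηpos : 0 < η := by rw [hη]; positivity
  have hηη₀ : η ≤ η₀ := by rw [hη]; linarith [min_le_left η₀ w₀.im]
  have hηw₀ : η < w₀.im := by rw [hη]; linarith [min_le_right η₀ w₀.im]
  set V : Set ℂ := {w : ℂ | η < w.im} ∩ ball 0 R with hV
  have hVH : closure V ⊆ upperHalfPlaneSet := fun w hw ↦ hηpos.trans_le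
    (closure_lt_subset_le continuous_const continuous_im (closure_mono inter_subset_left hw))
  have hw₀V : w₀ ∈ V := ⟨hηw₀, by rw [mem_ball_zero_iff, hR]; linarith [le_max_right R₀ ‖w₀‖]⟩
  have hdc : DiffContOnCl ℂ f V := ⟨hfd.mono (subset_closure.trans hVH), hfd.continuousOn.mono hVH⟩
  refine Complex.norm_le_of_forall_mem_frontier_norm_le (isBounded_ball.subset inter_subset_right)
    hdc (fun w hw ↦ ?_) (subset_closure hw₀V)
  have hwH : w ∈ upperHalfPlaneSet := hVH (frontier_subset_closure hw)
  have hwR : ‖w‖ ≤ R := by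
    have hwcl : w ∈ closure (ball (0 : ℂ) R) :=
      closure_mono inter_subset_right (frontier_subset_closure hw)
    rw [closure_ball 0 (by rw [hR]; positivity)] at hwcl
    exact mem_closedBall_zero_iff.1 hwcl
  rw [hnorm, Real.exp_le_exp]
  rcases frontier_inter_subset _ _ hw with ⟨h1, -⟩ | ⟨-, h2⟩
  · -- bottom edge `im w = η`
    have him : w.im = η := (frontier_lt_subset_eq continuous_const continuous_im h1 : η = w.im).symm
    linarith [hη₀Ψ w hwH hwR (by rw [him]; exact hηη₀)]
  · -- outer arc `‖w‖ = R`
    have hwR' : ‖w‖ = R := by simpa using frontier_ball_subset_sphere h2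
    linarith [hR₀ w hwH (by rw [hwR', hR]; linarith [le_max_left R₀ ‖w₀‖])]

/-! ### `|im (g_Q - id)| ≤ θ` on the symmetric domain, and the far field -/

/-- **`|im (E_Q(z) - L_Q - z)| ≤ θ` on `ℂ ∖ (Q ∪ Q̄)`** for a `*`-hull `Q ⊆ {Im ≤ θ}`: above the
axis `im Φ_Q - im ∈ [-θ, 0]` (`im_sub_le_im_starRMap`, `IsRestrictionMap.im_le_im`), below by the
symmetry `E_Q(z̄) = \overline{E_Q(z)}`, and `E_Q`, `L_Q` are real on `ℝ ∖ Q`. [folklore] -/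
theorem abs_im_starMap_sub_le {θ : ℝ} (hθ : 0 ≤ θ) (hQθ : ∀ z ∈ Q, z.im ≤ θ) {z : ℂ}
    (hz : z ∈ symmDomain Q) : |(starMap Q z - starShift Q - z).im| ≤ θ := by
  have hΦ := isRestrictionMap_starRMap hQ
  have hL : (starShift Q).im = 0 := starShift_im hQ
  -- the bound above the axis
  have hup : ∀ w ∈ upperHalfPlaneSet \ Q, |(starRMap Q hQ w).im - w.im| ≤ θ := fun w hw ↦ by
    have h1 := hQ.im_sub_le_im_starRMap hθ hQθ hw
    have h2 := hΦ.im_le_im hQ.isBoundedHull.1 hw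
    rw [abs_le]; constructor <;> linarith
  rw [starMap_eq hQ]
  rcases lt_trichotomy z.im 0 with hneg | h0 | hpos
  · have hcz : conj z ∈ upperHalfPlaneSet \ Q := ⟨by show 0 < (conj z).im; rw [conj_im]; linarith, hz.2⟩
    have h1 := hup _ hcz
    rw [hullExt_of_im_neg hneg]
    simp only [sub_im, conj_im, hL, sub_zero]
    rw [conj_im, ← abs_neg] at h1
    convert h1 using 2; ring
  · have hzr : z = ((z.re : ℝ) : ℂ) := Complex.ext rfl (by simp [h0])
    have h1 := hullExt_ofReal_im hQ.isBoundedHull hΦ (show ((z.re : ℝ) : ℂ) ∉ Q by rw [← hzr]; exact hz.1)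
    rw [← hzr] at h1
    simpa [sub_im, h1, hL, h0] using hθ
  · have hzU : z ∈ upperHalfPlaneSet \ Q := ⟨hpos, hz.1⟩
    simpa only [hullExt_of_mem_diff hzU, sub_im, hL, sub_zero] using hup z hzU

/-- **`g_Q = E_Q - L_Q` is `IsHydrodynamicAt g_Q 0 r`** when `Q ⊆ B̄(0, r)`: holomorphic on
`{|z| > r}`, `g_Q(z) - z → 0` at `∞` (`tendsto_hullExt_sub_self`), symmetric (`hullExt_conj`,
`L_Q ∈ ℝ`) and `im g_Q ≤ im` above (`hullExt_im_le`). [cite: Lawler2005, §3.4 Prop. 3.36] -/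
theorem isHydrodynamicAt_starMap_sub {r : ℝ} (hr : 0 < r) (hQr : Q ⊆ closedBall (0 : ℂ) r) :
    IsHydrodynamicAt (fun z ↦ starMap Q z - starShift Q) 0 r := by
  have hΦ := isRestrictionMap_starRMap hQ
  have hB := hQ.isBoundedHull
  have hL : (starShift Q).im = 0 := starShift_im hQ
  have hmem : ∀ z : ℂ, r < ‖z - ((0 : ℝ) : ℂ)‖ → z ∈ symmDomain Q := fun z hz ↦
    mem_symmDomain_of_lt_norm hQr (by simpa using hz)
  refine ⟨hr, ?_, ?_, fun z hz ↦ ?_, fun z hz hzi ↦ ?_⟩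
  · rw [starMap_eq hQ]
    exact ((differentiableOn_hullExt hB hΦ).mono fun z hz ↦ hmem z hz).sub_const _
  · have h1 := (tendsto_hullExt_sub_self hB hΦ).sub_const (hullShift (starRMap Q hQ))
    rw [sub_self] at h1
    rw [starMap_eq hQ, starShift_eq hQ]
    exact h1.congr fun z ↦ by ring
  · rw [starMap_eq hQ] at *
    rw [hullExt_conj hB hΦ (hmem z hz), map_sub, conj_eq_iff_im.2 hL]
  · rw [starMap_eq hQ, sub_im, hL, sub_zero]
    exact hullExt_im_le hB hΦ ⟨hzi, (hmem z hz).1⟩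

/-- **Far field: `|E_Q(z) - L_Q - z| ≤ 2θ` for `|z| ≥ 2r`** when the `*`-hull `Q ⊆ B̄(0, r)` has
height `≤ θ`: the inverted function `f(w) = g_Q(1/w) - 1/w` is holomorphic on `|w| < 1/r`
(`IsHydrodynamicAt.differentiableOn_invertAt`), vanishes at `0`, and `re (-i f) = im f ≤ θ`, so
Borel–Carathéodory (`Complex.borelCaratheodory_zero`) bounds `|f(w)| ≤ 2θ|w|/(1/r - |w|) ≤ 2θ`
for `|w| ≤ 1/(2r)`. [folklore] -/
theorem norm_starMap_sub_le_of_le_norm {θ r : ℝ} (hθ : 0 < θ) (hQθ : ∀ z ∈ Q, z.im ≤ θ)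
    (hr : 0 < r) (hQr : Q ⊆ closedBall (0 : ℂ) r) {z : ℂ} (hz : 2 * r ≤ ‖z‖) :
    ‖starMap Q z - starShift Q - z‖ ≤ 2 * θ := by
  set g : ℂ → ℂ := fun z ↦ starMap Q z - starShift Q with hg
  have hH : IsHydrodynamicAt g 0 r := hQ.isHydrodynamicAt_starMap_sub hr hQr
  set F : ℂ → ℂ := fun w ↦ -I * invertAt g 0 w with hF
  have hFd : DifferentiableOn ℂ F (ball 0 r⁻¹) :=
    (differentiableOn_const _).mul hH.differentiableOn_invertAt
  -- `re F = im f ≤ θ` on the disc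
  have hFre : MapsTo F (ball 0 r⁻¹) {w : ℂ | w.re ≤ θ} := by
    intro w hw
    have hre : (F w).re = (invertAt g 0 w).im := by simp [hF, mul_re]
    rw [mem_setOf_eq, hre]
    rcases eq_or_ne w 0 with rfl | hw0
    · simp [hθ.le]
    have hwr : r < ‖w⁻¹‖ := by
      rw [mem_ball_zero_iff] at hw
      rwa [norm_inv, lt_inv_comm₀ hr (norm_pos_iff.2 hw0)]
    rw [IsHydrodynamicAt.invertAt_of_ne hw0, ofReal_zero, zero_add, sub_zero]
    exact (le_abs_self _).trans
      (hQ.abs_im_starMap_sub_le hθ.le hQθ (mem_symmDomain_of_lt_norm hQr hwr))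
  -- Borel–Carathéodory at `w = 1/z`
  have hz0 : z ≠ 0 := by rintro rfl; rw [norm_zero] at hz; linarith
  have hr' : (0 : ℝ) < r⁻¹ := inv_pos.2 hr
  have hw : ‖z⁻¹‖ ≤ r⁻¹ / 2 := by
    rw [norm_inv]
    calc ‖z‖⁻¹ ≤ (2 * r)⁻¹ := inv_anti₀ (by positivity) hz
      _ = r⁻¹ / 2 := by ring
  have hBC := Complex.borelCaratheodory_zero hθ hFd hFre hr'
    (show z⁻¹ ∈ ball (0 : ℂ) r⁻¹ by rw [mem_ball_zero_iff]; linarith) (by simp [hF])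
  have hFz : ‖F z⁻¹‖ = ‖starMap Q z - starShift Q - z‖ := by
    have h1 : invertAt g 0 (z - ((0 : ℝ) : ℂ))⁻¹ = g z - z :=
      IsHydrodynamicAt.invertAt_inv_sub (by rw [ofReal_zero]; exact hz0)
    rw [ofReal_zero, sub_zero] at h1
    have h2 : F z⁻¹ = -I * (g z - z) := by simp only [hF, h1]
    rw [h2, norm_mul, norm_neg, norm_I, one_mul]
  rw [← hFz]
  refine hBC.trans ?_
  rw [div_le_iff₀ (by linarith)]
  nlinarith [norm_nonneg z⁻¹]

end IsStarHull

/-! ### Assembly: thin `*`-hulls have small `L` -/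

/-- The open set `{|Re z| < c} ∪ {Im z > 1}` is preconnected (two convex sets meeting at `2i`).
[folklore] -/
theorem isPreconnected_strip_union_halfPlane {c : ℝ} (hc : 0 < c) :
    IsPreconnected ({z : ℂ | |z.re| < c} ∪ {z : ℂ | 1 < z.im}) := by
  have h1 : Convex ℝ {z : ℂ | |z.re| < c} := by
    have : {z : ℂ | |z.re| < c} = {z : ℂ | z.re < c} ∩ {z : ℂ | -c < z.re} := by
      ext z; simp only [mem_setOf_eq, mem_inter_iff, abs_lt]; tauto
    rw [this]
    exact (convex_halfSpace_re_lt c).inter (convex_halfSpace_re_gt (-c))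
  refine IsPreconnected.union (2 * I) ?_ ?_ h1.isPreconnected (convex_halfSpace_im_gt 1).isPreconnected
  · show |(2 * I).re| < c
    simpa using hc
  · show 1 < (2 * I).im
    norm_num

/-- **Thin `*`-hulls have a small hydrodynamic constant** (uniformly): for `0 < c ≤ M` and
`ε > 0` there is `θ > 0` such that every `*`-hull `Q ⊆ {c ≤ |Re w| ≤ M, Im w ≤ θ}` has
`|L_Q| ≤ ε`. Proof: `|im h_Q| ≤ θ` on `ℂ ∖ (Q ∪ Q̄) ⊇ s = {|Re z| < c} ∪ {Im z > 1}`
(`abs_im_starMap_sub_le`), `|h_Q(2(M+1)i)| ≤ 2θ` (far field), and Borel–Carathéodory chained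
along `s` (`exists_forall_norm_le_mul_of_abs_im_le`) gives `|h_Q(0) - h_Q(2(M+1)i)| ≤ 3Cθ`
with `C = C(c, M)`; finally `h_Q(0) = -L_Q` (`E_Q(0) = 0`).
[cite: LawlerSchrammWerner2003Restriction, §5 (h_t, W̃_t = W_t + L_A − L_{B_t})] -/
theorem exists_forall_abs_starShift_le_of_thin {c M : ℝ} (hc : 0 < c) (hcM : c ≤ M) {ε : ℝ} (hε : 0 < ε) :
    ∃ θ : ℝ, 0 < θ ∧ ∀ Q : Set ℂ, IsStarHull Q →
      Q ⊆ {w : ℂ | c ≤ |w.re| ∧ |w.re| ≤ M ∧ w.im ≤ θ} → ‖starShift Q‖ ≤ ε := by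
  -- the domain, the radius, the far point
  set s : Set ℂ := {z : ℂ | |z.re| < c} ∪ {z : ℂ | 1 < z.im} with hs
  have hM : 0 < M := hc.trans_le hcM
  set r : ℝ := M + 1 with hr
  set z₀ : ℂ := ((2 * r : ℝ) : ℂ) * I with hz₀
  have hz₀im : z₀.im = 2 * r := by simp [hz₀]
  have hz₀n : ‖z₀‖ = 2 * r := by
    rw [hz₀, norm_mul, norm_I, mul_one, norm_real, Real.norm_of_nonneg (by positivity)]
  have hz₀s : z₀ ∈ s := Or.inr (by show 1 < z₀.im; rw [hz₀im, hr]; linarith)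
  have h0s : (0 : ℂ) ∈ s := Or.inl (by show |(0 : ℂ).re| < c; simpa using hc)
  have hso : IsOpen s := (isOpen_lt (continuous_abs.comp continuous_re) continuous_const).union
    (isOpen_lt continuous_const continuous_im)
  -- admissible pairs `(θ, Q)`
  set ι := {p : ℝ × Set ℂ // 0 < p.1 ∧ p.1 ≤ 1 ∧ IsStarHull p.2 ∧
    p.2 ⊆ {w : ℂ | c ≤ |w.re| ∧ |w.re| ≤ M ∧ w.im ≤ p.1}} with hι
  have hfacts : ∀ i : ι, (∀ w ∈ i.1.2, w.im ≤ i.1.1) ∧ i.1.2 ⊆ closedBall (0 : ℂ) r ∧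
      s ⊆ symmDomain i.1.2 := by
    rintro ⟨⟨θ, Q⟩, hθ, hθ1, hQ, hQb⟩
    refine ⟨fun w hw ↦ (hQb hw).2.2, fun w hw ↦ ?_, fun z hz ↦ ⟨fun hzQ ↦ ?_, fun hzQ ↦ ?_⟩⟩
    · have h := hQb hw
      rw [mem_closedBall_zero_iff]
      calc ‖w‖ ≤ |w.re| + |w.im| := norm_le_abs_re_add_abs_im w
        _ ≤ M + 1 := by rw [abs_of_nonneg (hQ.isBoundedHull.im_nonneg hw)]; linarith [h.2.1, h.2.2]
    · have h := hQb hzQ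
      rcases hz with hz | hz
      · exact absurd h.1 (not_le.2 hz)
      · linarith [h.2.2, show 1 < z.im from hz]
    · have h : c ≤ |(conj z).re| := (hQb hzQ).1
      have h0 := hQ.isBoundedHull.im_nonneg hzQ
      rw [conj_re] at h
      rw [conj_im] at h0
      rcases hz with hz | hz
      · exact absurd h (not_le.2 hz)
      · linarith [show 1 < z.im from hz]
  -- the family `G i = h_Q - h_Q(z₀)`, `h_Q = E_Q - L_Q - id`, and its bounds
  set G : ι → ℂ → ℂ := fun i z ↦
    (starMap i.1.2 z - starShift i.1.2 - z) - (starMap i.1.2 z₀ - starShift i.1.2 - z₀) with hG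
  have hGd : ∀ i, DifferentiableOn ℂ (G i) s := fun i ↦ by
    have hQ := i.2.2.2.1
    have hd : DifferentiableOn ℂ (starMap i.1.2) s := by
      rw [starMap_eq hQ]
      exact (differentiableOn_hullExt hQ.isBoundedHull (isRestrictionMap_starRMap hQ)).mono
        (hfacts i).2.2
    exact ((hd.sub_const _).sub differentiableOn_id).sub_const _
  have hfar : ∀ i : ι, ‖starMap i.1.2 z₀ - starShift i.1.2 - z₀‖ ≤ 2 * i.1.1 := fun i ↦
    i.2.2.2.1.norm_starMap_sub_le_of_le_norm i.2.1 (hfacts i).1 (by positivity) (hfacts i).2.1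
      hz₀n.ge
  have him : ∀ i, ∀ z ∈ s, |(G i z).im| ≤ 3 * i.1.1 := fun i z hz ↦ by
    have h1 := i.2.2.2.1.abs_im_starMap_sub_le i.2.1.le (hfacts i).1 ((hfacts i).2.2 hz)
    have h2 := (abs_im_le_norm _).trans (hfar i)
    set A := starMap i.1.2 z - starShift i.1.2 - z with hA
    set B := starMap i.1.2 z₀ - starShift i.1.2 - z₀ with hB
    rw [show G i z = A - B from rfl, sub_im]
    linarith [abs_sub A.im B.im]
  obtain ⟨C, hC⟩ := exists_forall_norm_le_mul_of_abs_im_le hso (isPreconnected_strip_union_halfPlane hc)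
    (fun i ↦ by linarith [i.2.1]) hGd him hz₀s (fun i ↦ sub_self _) isCompact_singleton
    (singleton_subset_iff.2 h0s)
  -- the choice of `θ`
  set C' : ℝ := 3 * max C 0 + 2 with hC'
  have hC'pos : 0 < C' := by positivity
  have hθpos : 0 < min 1 (ε / C') := lt_min one_pos (div_pos hε hC'pos)
  refine ⟨min 1 (ε / C'), hθpos, fun Q hQ hQb ↦ ?_⟩
  set θ : ℝ := min 1 (ε / C') with hθ
  set i : ι := ⟨(θ, Q), hθpos, min_le_left _ _, hQ, hQb⟩ with hi
  have h1 : ‖G i 0‖ ≤ C * (3 * θ) := hC i 0 (mem_singleton _)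
  have h2 : ‖starMap Q z₀ - starShift Q - z₀‖ ≤ 2 * θ := hfar i
  -- `h_Q(0) = -L_Q`
  have hG0 : G i 0 = -starShift Q - (starMap Q z₀ - starShift Q - z₀) := by
    show (starMap Q 0 - starShift Q - 0) - (starMap Q z₀ - starShift Q - z₀) = _
    rw [starMap_zero hQ, zero_sub, sub_zero]
  have h3 : C * (3 * θ) ≤ max C 0 * (3 * θ) := mul_le_mul_of_nonneg_right (le_max_left C 0) (by positivity)
  calc ‖starShift Q‖ = ‖-starShift Q‖ := (norm_neg _).symm
    _ = ‖G i 0 + (starMap Q z₀ - starShift Q - z₀)‖ := by rw [hG0, sub_add_cancel]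
    _ ≤ ‖G i 0‖ + ‖starMap Q z₀ - starShift Q - z₀‖ := norm_add_le _ _
    _ ≤ C' * θ := by rw [hC']; linarith
    _ ≤ ε := by
        have : θ ≤ ε / C' := min_le_right _ _
        rwa [le_div_iff₀ hC'pos, mul_comm] at this

end Literature.Probability.RandomPlanarGeometry
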